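import Summits.CriticalPhenomena.PercolationContinuityZ3.Theorems.Transplant.SkelFrmFromBChoiceSlotsPx
import Summits.CriticalPhenomena.PercolationContinuityZ3.Theorems.Transplant.SkelFrmFromBChoiceGeomVPx
import Summits.CriticalPhenomena.PercolationContinuityZ3.Theorems.Transplant.SkelFrmFrom1RootHoldsQ3VNodePx
import Summits.CriticalPhenomena.PercolationContinuityZ3.Theorems.Transplant.SkelFrmFrom1FaceHoldsQ3VNodePx
import Summits.CriticalPhenomena.PercolationContinuityZ3.Theorems.Transplant.SkelFrmFrom1ReachHoldsQ3VNodePx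
import Summits.CriticalPhenomena.PercolationContinuityZ3.Theorems.Transplant.PlanarSkeletonFrmFrom1Px
import Summits.CriticalPhenomena.PercolationContinuityZ3.Theorems.Transplant.PlanarSkeletonFrmFromProxies
import Summits.CriticalPhenomena.PercolationContinuityZ3.Theorems.Transplant.SkelFrmFrom1SkeletonOnly
import Summits.CriticalPhenomena.PercolationContinuityZ3.Theorems.Transplant.PlanarSkeletonFrmRays
import HarnessLib

/-!
# THE GEN NODE WITH PROXIES (design owner p3 g27 2026-08-27, after the U_s node p483212): **`θ_t(p_c) = 0` for EVERY locally finite graph carrying a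
# `PlanarSkeletonFrmFrom` WITH ANY NUMBER OF BASE-VERTEX TYPES, at every type `t` that admits proxies `Φ.HasProxies t D`** — the four landed GEN column tops
# ∀ `D` (Geom p465798 · (R) p473968 · (F) p482326 · (C) p475664) fed into «PlanarSkeletonFrmFrom1Px» §2 (the multi-type closure with proxies), Φ2 at `p_c` by
# «SkelFrmFrom1SkeletonOnly»; plus §2 the purely combinatorial SUFFICIENT CONDITION for proxies: the base types are CHART-ALIGNED with `t`

builds on p205010 (kernel theorem, internal audit signed; external expert review pending).  Lane `prim-bschramm`, seat `prim-bschramm-p3` gen 27 (design owner);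
helper file (`--supports stmt-CriticalPhenomena-4575 --as helper`).  Nothing here edits or restates a `@[conjecture]`; nothing is claimed about the multi-type
scaled node, the end-state node or Conj. 4 in general.  WHY THIS IS A THEOREM TODAY: the GEN wave's column obligations are stated for an ARBITRARY
`PlanarSkeletonFrmFrom` under `hP : Φ.HasProxies t D` (the one-type hypothesis of U entered only through `HasProxies.of_types_eq`, radius `0`, and U_s's through
the coarse skeleton's proxies at radius `D(Φ)`); the tops are ∀ `D`; so the multi-type carrier with proxies closes by composition.
§1 `frmFromProx_criticalContinuity_holds (Φ) (ht : t ∈ Φ.types) (hP : Φ.HasProxies t D) : θ_t(p_c(G,t)) = 0`, the drop form, and the orbit form (every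
vertex framed from `t`).  §2 `PlanarSkeletonFrmFrom.HasProxies.of_aligned`: if every base type `s` sees, within graph distance `D`, a vertex `u` FRAMED FROM `t`
with the SAME chart value `Φ.φ u = Φ.φ s`, then `Φ.HasProxies t D` (compose the frame `s ↦ c` with `t ↦ u`; automorphisms are isometries) — the finite check the
next rung (Cayley graphs of groups that surject onto `ℤ²` only VIRTUALLY: types = cosets, chart constant on coset representatives) is designed to meet.
[cite: BenjaminiSchramm1996, Conj. 4] [cite: KozmaNitzan2024, §1 p. 2 (approach 1); §4 Theorem 6 (pp. 25–31)] [cite: Hutchcroft2016, Thm. 1]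
[cite: LyonsPeres2016, Thm. 7.6] [cite: AizenmanGrimmett1991, Thm 1 (essential enhancements)]
-/

noncomputable section

namespace Summit.CriticalPhenomena.PercolationContinuityZ3.Theorems

namespace Transplant

open MeasureTheory Literature.Probability.Percolation Literature.Probability.LatticeModels SimpleGraph
open Literature.Barriers.CriticalPhenomena (graphBall countable_of_connected_of_locallyFinite)
open scoped Classical

/-! ## §1 The multi-type carrier with proxies: `θ_t(p_c) = 0` -/

/-- **`θ_t(p_c) = 0` FOR EVERY `PlanarSkeletonFrmFrom` — ANY NUMBER OF TYPES — AT EVERY BASE TYPE WITH PROXIES**: on a locally finite graph `G` carrying a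
frames-only planar skeleton `Φ` with cylinders connected from some width on, every base type `t ∈ Φ.types` admitting proxies at some radius `D`
(`Φ.HasProxies t D`: every vertex has, within distance `D`, a vertex framed from `t` with the same chart value) has `θ_t(p_c(G,t)) = 0`.  The four GEN column tops at
the TUPLE Px OF RECORD at radius `D` through «PlanarSkeletonFrmFrom1Px» `theta_criticalProbIOf_eq_zero_of_choiceFnNQLTKPxAt`; Φ2 at `p_c` by
`PlanarSkeletonFrmFrom.cylSubcritical_criticalProb`.
builds on p205010 (kernel theorem, internal audit signed; external expert review pending). [cite: BenjaminiSchramm1996, Conj. 4] [cite: KozmaNitzan2024, §4] -/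
theorem frmFromProx_criticalContinuity_holds {V : Type} (G : SimpleGraph V) [G.LocallyFinite] (Φ : PlanarSkeletonFrmFrom G) {t : V} (ht : t ∈ Φ.types)
    {D : ℕ} (hP : Φ.HasProxies t D) : theta G t (criticalProbIOf G t) = 0 :=
  PlanarSkeletonFrmFrom.theta_criticalProbIOf_eq_zero_of_choiceFnNQLTKPxAt PlanarSkeletonFrm.NegB.LfQ (fun x : ℝ => x ^ 3) (fun _ hx => pow_pos hx 3) 480
    (PlanarSkeletonFrmFrom.frmChoiceAllQ3VPx D (PlanarSkeletonFrmFrom.NegB.gvPx D) (PlanarSkeletonFrmFrom.NegB.fvPx D) (PlanarSkeletonFrmFrom.NegB.PvPx D)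
      (PlanarSkeletonFrmFrom.NegB.SUS (PlanarSkeletonFrmFrom.NegB.exPx D) (PlanarSkeletonFrmFrom.NegB.mxPx D)) (PlanarSkeletonFrmFrom.NegB.cvPx D)
      (PlanarSkeletonFrmFrom.NegB.hvPx D) PlanarSkeletonFrmFrom.NegB.BSlot.small3)
    (PlanarSkeletonFrmFrom.geomHoldsNQFnPxAt_frmChoiceAllQ3VPx D _ _ _ _ _ _ _)
    (PlanarSkeletonFrmFrom.NegB.rootHoldsNQWFnLKPxAt_frmChoiceAllQ3VPx_node D 480 (by norm_num))
    (PlanarSkeletonFrmFrom.NegB.faceHoldsRNQFnLTKPxAt_frmChoiceAllQ3VPx_node D 480 le_rfl)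
    (PlanarSkeletonFrmFrom.reachHoldsRHNQFnLKPxAt_frmChoiceAllQ3VPx_node D 480 (by norm_num))
    Φ ht hP (Φ.cylSubcritical_criticalProb t)

/-- **The same-`p` drop for the multi-type carrier with proxies** — every `p` with subcritical cylinders and `θ_t(p) > 0` admits `q < p` with `θ_t(q) > 0`; no growth,
uniqueness or `p < 1` hypothesis («PlanarSkeletonFrmFrom1Px» `drop_of_choiceFnNQLTKPxAt_at` at the four tops).
builds on p205010 (kernel theorem, internal audit signed; external expert review pending). [cite: BenjaminiSchramm1996, Conj. 4] -/
theorem frmFromProx_drop_holds {V : Type} (G : SimpleGraph V) [G.LocallyFinite] (Φ : PlanarSkeletonFrmFrom G) {t : V} (ht : t ∈ Φ.types)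
    {D : ℕ} (hP : Φ.HasProxies t D) (p : unitInterval) (hC : Φ.CylSubcritical p) (hθ : 0 < theta G t p) :
    ∃ q : unitInterval, (q : ℝ) < p ∧ 0 < theta G t q :=
  PlanarSkeletonFrmFrom.drop_of_choiceFnNQLTKPxAt_at PlanarSkeletonFrm.NegB.LfQ (fun x : ℝ => x ^ 3) (fun _ hx => pow_pos hx 3) 480
    (PlanarSkeletonFrmFrom.frmChoiceAllQ3VPx D (PlanarSkeletonFrmFrom.NegB.gvPx D) (PlanarSkeletonFrmFrom.NegB.fvPx D) (PlanarSkeletonFrmFrom.NegB.PvPx D)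
      (PlanarSkeletonFrmFrom.NegB.SUS (PlanarSkeletonFrmFrom.NegB.exPx D) (PlanarSkeletonFrmFrom.NegB.mxPx D)) (PlanarSkeletonFrmFrom.NegB.cvPx D)
      (PlanarSkeletonFrmFrom.NegB.hvPx D) PlanarSkeletonFrmFrom.NegB.BSlot.small3)
    (PlanarSkeletonFrmFrom.geomHoldsNQFnPxAt_frmChoiceAllQ3VPx D _ _ _ _ _ _ _)
    (PlanarSkeletonFrmFrom.NegB.rootHoldsNQWFnLKPxAt_frmChoiceAllQ3VPx_node D 480 (by norm_num))
    (PlanarSkeletonFrmFrom.NegB.faceHoldsRNQFnLTKPxAt_frmChoiceAllQ3VPx_node D 480 le_rfl)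
    (PlanarSkeletonFrmFrom.reachHoldsRHNQFnLKPxAt_frmChoiceAllQ3VPx_node D 480 (by norm_num))
    Φ ht hP p hC hθ

/-- **… at every vertex FRAMED FROM `t`**: `θ_v(p_c(G,v)) = 0` for every `v = α t` with `α` a graph automorphism (frames are automorphisms: `θ` and `p_c` are
transported).
builds on p205010 (kernel theorem, internal audit signed; external expert review pending). [cite: BenjaminiSchramm1996, Conj. 4] -/
theorem frmFromProx_criticalContinuity_holds_of_iso {V : Type} (G : SimpleGraph V) [G.LocallyFinite] (Φ : PlanarSkeletonFrmFrom G) {t : V} (ht : t ∈ Φ.types)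
    {D : ℕ} (hP : Φ.HasProxies t D) (α : G ≃g G) : theta G (α t) (criticalProbIOf G (α t)) = 0 := by
  haveI : Countable V := countable_of_connected_of_locallyFinite G (Φ.graph_connected t) t
  have hbase := frmFromProx_criticalContinuity_holds G Φ ht hP
  have hθ := theta_iso α t (criticalProbIOf G t)
  have hpc := criticalProb_iso α t
  have e : criticalProbIOf G (α t) = criticalProbIOf G t := Subtype.ext hpc
  rw [e, hθ]
  exact hbase

/-! ## §2 A sufficient condition for proxies: chart-aligned types -/

namespace PlanarSkeletonFrmFrom

variable {V : Type} {G : SimpleGraph V} [G.LocallyFinite]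

/-- **CHART-ALIGNED TYPES GIVE PROXIES**: if every base type `s ∈ Φ.types` has, within graph distance `D`, a vertex `u` framed from `t` (an automorphism
`γ : t ↦ u` translating the chart) with the SAME chart value `Φ.φ u = Φ.φ s`, then EVERY vertex has a proxy of type `t` at radius `D` — compose the frame
`β : s ↦ c` of the vertex `c` with `γ`; automorphisms preserve graph balls.  (One type: `u := t`, `D := 0` — `HasProxies.of_types_eq`.) [this work] -/
theorem HasProxies.of_aligned (Φ : PlanarSkeletonFrmFrom G) {t : V} {D : ℕ}
    (hal : ∀ s ∈ Φ.types, ∃ (u : V) (γ : G ≃g G), γ t = u ∧ (∀ w, Φ.φ (γ w) = Φ.φ w + (Φ.φ u - Φ.φ t)) ∧ Φ.φ u = Φ.φ s ∧ s ∈ graphBall G u D) :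
    Φ.HasProxies t D := by
  intro c
  obtain ⟨s, hs, β, hβs, hβφ⟩ := Φ.frame c
  obtain ⟨u, γ, hγt, hγφ, hus, hsu⟩ := hal s hs
  refine ⟨β u, γ.trans β, ?_, ?_, ?_, ?_⟩
  · show β (γ t) = β u
    rw [hγt]
  · intro w
    show Φ.φ (β (γ w)) = Φ.φ w + (Φ.φ (β u) - Φ.φ t)
    rw [hβφ, hγφ, hβφ]
    abel
  · rw [hβφ, hus]; abel
  · have h := PlanarSkeletonFrm.mem_graphBall_map β hsu
    rwa [hβs] at h

end PlanarSkeletonFrmFrom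

end Transplant

end Summit.CriticalPhenomena.PercolationContinuityZ3.Theorems

end
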